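import Summits.CriticalPhenomena.PercolationContinuityZ3.Theorems.Transplant.PatternGraphOrbits
import HarnessLib

/-!
# Customer (c2) of the pattern-graph front-end: the FOUR-SHEET ROTOR PATTERN WITH TWO RUNGS (the coset picture of
# `Cay(ℤ² ⋊ C₄; τ, ρτρ⁻¹, (e₀,ρ), (e₁,ρ))`) — `θ_v(p_c) = 0 ∧ p_c < 1` UNCONDITIONALLY

builds on p205010 (kernel theorem, internal audit signed; external expert review pending): through `PatternGraph.criticalContinuity/conj4/drop`
(«PatternGraphOrbits» p496621, design owner p3 g28) over the orbit theorem («AutChartOrbitsCriticalContinuity» p493117 / p495338).  Lane `prim-bschramm`,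
seat `prim-bschramm-stmt` gen 32 (port pen; row (c2) handed BY NAME by the design owner p3 g28, P3-NILPOTENT §20.2 (c2) / §20.7).  Helper file
(`--supports stmt-CriticalPhenomena-4575 --as helper`).

THE GRAPH.  `Γ := Multiplicative (Site 2)` (the group `ℤ²` written multiplicatively), `k := 4` sheets, chart `c := MonoidHom.id Γ` (the position).  Write
`e₀, e₁` for the unit vectors and `R` for the rotation by `+90°` (`R e₀ = e₁`, `R e₁ = −e₀`), so `R^j e₀ = e₀, e₁, −e₀, −e₁` (`rot0 j`) and `R^j e₁ = e₁, −e₀, −e₁, e₀`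
(`rot1 j`) for `j = 0, 1, 2, 3`.  The pattern `pat j` of sheet `j` consists of the four IN-SHEET letters `±e₀, ±e₁` (`unit i`, `(unit i)⁻¹`) and the two FORWARD
RUNGS `(R^j e₀, j+1)`, `(R^j e₁, j+1)` into sheet `j+1 (mod 4)`; the backward rungs are the same bonds read from the other end (the pattern graph is symmetrised).
So `(x, j) ∼ (x ± e₀, j)`, `(x, j) ∼ (x ± e₁, j)`, `(x, j) ∼ (x + R^j e₀, j+1)`, `(x, j) ∼ (x + R^j e₁, j+1)`: every vertex has degree `8`.
This is the right Cayley graph of `ℤ² ⋊ C₄ = {(x, ρ^j)}` (`(x, ρ^j)·(y, ρ^i) = (x + R^j y, ρ^{j+i})`) on the alphabet `{τ = (e₀,1), ρτρ⁻¹ = (e₁,1), (e₀,ρ), (e₁,ρ)}^{±1}`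
read on the four cosets of `ℤ²`: `(x, ρ^j)·τ^{±1} = (x ± R^j e₀, ρ^j)`, `(x, ρ^j)·(ρτρ⁻¹)^{±1} = (x ± R^j e₁, ρ^j)` (as a SET the in-sheet displacements
`{±R^j e₀, ±R^j e₁}` are `{±e₀, ±e₁}` on every sheet), `(x, ρ^j)·(eᵢ,ρ) = (x + R^j eᵢ, ρ^{j+1})` — an identification stated in coordinates, NOT typed here.
WORDS (rule P5-SHARPNESS §59.3, P3-NILPOTENT §20.7): the graph is vertex-transitive (as every Cayley graph); the left `ℤ²`-translations translate the chart and have the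
four sheets as orbits; `((0,1), ρ²)`-type elements normalise the alphabet but do not translate the chart; whether some transitive group of automorphisms translates a
rank-two chart (which would put the graph under a one-type node, V153 clause 3) is OPEN — so this file is a CUSTOMER of the orbit theorem and NO 'first' /
'outside every one-type node' word is attached to it.  Kernel content: `θ_v(p_c) = 0`, `p_c < 1` and the same-`p` drop on the explicit graph `PatternGraph.graph pat`.
[cite: BenjaminiSchramm1996, Conj. 4; §2 (Cayley graphs, quasi-transitive graphs)] [cite: KozmaNitzan2024, §4 p. 16 (Lemma 8)]
-/

noncomputable section

namespace Summit.CriticalPhenomena.PercolationContinuityZ3.Theorems.Transplant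

open MeasureTheory Literature.Probability.Percolation Literature.Probability.LatticeModels SimpleGraph
open scoped Classical

namespace Z2RotC4TwoRungs

/-! ## §1 The letters and the pattern -/

/-- The unit axis letter `eᵢ` of `ℤ²`, written multiplicatively. [folklore] -/
def unit (i : Fin 2) : Multiplicative (Site 2) := Multiplicative.ofAdd (Pi.single i 1)

/-- `R^j e₀` for `j = 0, 1, 2, 3` (`R` = rotation by `+90°`): `e₀, e₁, −e₀, −e₁`. [this work] -/
def rot0 : Fin 4 → Site 2 := ![Pi.single 0 1, Pi.single 1 1, -Pi.single 0 1, -Pi.single 1 1]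

/-- `R^j e₁ = R^{j+1} e₀` for `j = 0, 1, 2, 3`: `e₁, −e₀, −e₁, e₀`. [this work] -/
def rot1 : Fin 4 → Site 2 := ![Pi.single 1 1, -Pi.single 0 1, -Pi.single 1 1, Pi.single 0 1]

/-- `R^j e₁ = R^{j+1} e₀`: the second rung table is the first one shifted by a sheet. [folklore] -/
theorem rot1_eq_rot0_succ (j : Fin 4) : rot1 j = rot0 (j + 1) := by
  fin_cases j <;> decide

/-- **The in-sheet part of the coset picture**: on every sheet the displacement set `{±R^j e₀, ±R^j e₁}` of the letters `τ^{±1}`, `(ρτρ⁻¹)^{±1}` IS `{±e₀, ±e₁}`.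
[this work] -/
theorem inSheet_displacements_eq (j : Fin 4) :
    ({rot0 j, -rot0 j, rot1 j, -rot1 j} : Finset (Site 2)) = {Pi.single 0 1, -Pi.single 0 1, Pi.single 1 1, -Pi.single 1 1} := by
  fin_cases j <;> decide

/-- **The pattern of the four-sheet rotor graph with two rungs**: sheet `j` carries the in-sheet letters `±e₀, ±e₁` and the forward rungs `(R^j e₀, j+1)`,
`(R^j e₁, j+1)`. [this work] -/
def pat (j : Fin 4) : Finset (Multiplicative (Site 2) × Fin 4) :=
  {(unit 0, j), ((unit 0)⁻¹, j), (unit 1, j), ((unit 1)⁻¹, j), (Multiplicative.ofAdd (rot0 j), j + 1), (Multiplicative.ofAdd (rot1 j), j + 1)}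

/-- `toAdd (unit i) = eᵢ`. [folklore] -/
@[simp] theorem toAdd_unit (i : Fin 2) : Multiplicative.toAdd (unit i) = Pi.single i 1 := rfl

/-- The in-sheet letters belong to the pattern of every sheet. [folklore] -/
theorem unit_mem_pat (i : Fin 2) (j : Fin 4) : (unit i, j) ∈ pat j ∧ ((unit i)⁻¹, j) ∈ pat j := by
  fin_cases i <;> simp [pat]

/-- The forward rung `(R^j e₀, j+1)` belongs to the pattern of sheet `j`. [folklore] -/
theorem rung_mem_pat (j : Fin 4) : (Multiplicative.ofAdd (rot0 j), j + 1) ∈ pat j := by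
  simp [pat]

/-! ## §2 The three obligations of the front-end: unit range, in-sheet axis steps, connectedness -/

/-- The letter tables have sup-norm `≤ 1` (all entries are `± eᵢ`). [folklore] -/
theorem abs_tables_le : (∀ i' i : Fin 2, |(Pi.single i' (1 : ℤ) : Site 2) i| ≤ 1 ∧ |(-(Pi.single i' (1 : ℤ) : Site 2)) i| ≤ 1) ∧
    (∀ j : Fin 4, ∀ i : Fin 2, |rot0 j i| ≤ 1 ∧ |rot1 j i| ≤ 1) := by
  refine ⟨?_, ?_⟩ <;> decide

/-- **Unit range**: every pattern letter has chart sup-norm `≤ 1` (chart = position, `c = id`). [folklore] -/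
theorem hrange : ∀ j : Fin 4, ∀ p ∈ pat j, ∀ i : Fin 2,
    |Multiplicative.toAdd ((MonoidHom.id (Multiplicative (Site 2))) p.1) i| ≤ 1 := by
  intro j p hp i
  obtain ⟨hin, hrot⟩ := abs_tables_le
  simp only [pat, Finset.mem_insert, Finset.mem_singleton] at hp
  rcases hp with rfl | rfl | rfl | rfl | rfl | rfl
  · simpa using (hin 0 i).1
  · simpa [toAdd_inv] using (hin 0 i).2
  · simpa using (hin 1 i).1
  · simpa [toAdd_inv] using (hin 1 i).2
  · simpa using (hrot j i).1
  · simpa using (hrot j i).2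

/-- **In-sheet axis steps**: every sheet carries the letters `±e₀, ±e₁` with chart value `± eᵢ` exactly. [folklore] -/
theorem hstep : ∀ (j : Fin 4) (i : Fin 2) (σ : ℤˣ), ∃ p ∈ pat j, p.2 = j ∧
    Multiplicative.toAdd ((MonoidHom.id (Multiplicative (Site 2))) p.1) = Pi.single i (σ : ℤ) := by
  intro j i σ
  rcases Int.units_eq_one_or σ with rfl | rfl
  · exact ⟨(unit i, j), (unit_mem_pat i j).1, rfl, by simp⟩
  · exact ⟨((unit i)⁻¹, j), (unit_mem_pat i j).2, rfl, by simp [toAdd_inv, Pi.single_neg]⟩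

/-- `v = v₀ e₀ + v₁ e₁` in `ℤ²`. [folklore] -/
theorem eq_sum_single (v : Site 2) : v = v 0 • (Pi.single 0 1 : Site 2) + v 1 • (Pi.single 1 1 : Site 2) := by
  funext i
  fin_cases i <;> simp

/-- **The in-sheet letters generate `Γ = ℤ²`**: `⟨e₀, e₁⟩ = ⊤` (multiplicatively). [folklore] -/
theorem closure_units_eq_top : Subgroup.closure ({unit 0, unit 1} : Set (Multiplicative (Site 2))) = ⊤ := by
  refine (Subgroup.eq_top_iff' _).2 fun x => ?_
  obtain ⟨v, rfl⟩ : ∃ v : Site 2, Multiplicative.ofAdd v = x := ⟨Multiplicative.toAdd x, rfl⟩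
  have h0 : unit 0 ∈ Subgroup.closure ({unit 0, unit 1} : Set (Multiplicative (Site 2))) := Subgroup.subset_closure (by simp)
  have h1 : unit 1 ∈ Subgroup.closure ({unit 0, unit 1} : Set (Multiplicative (Site 2))) := Subgroup.subset_closure (by simp)
  rw [eq_sum_single v, ofAdd_add, ofAdd_zsmul, ofAdd_zsmul]
  exact mul_mem (zpow_mem h0 _) (zpow_mem h1 _)

/-- Every vertex of a sheet is joined to the identity vertex of that sheet (walk the in-sheet letters). [folklore] -/
theorem hsheet (j : Fin 4) (g : Multiplicative (Site 2)) : (PatternGraph.graph pat).Reachable ((1 : Multiplicative (Site 2)), j) (g, j) := by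
  refine PatternGraph.reachable_sheet pat closure_units_eq_top j ?_ g
  intro s hs
  simp only [Set.mem_insert_iff, Set.mem_singleton_iff] at hs
  rcases hs with rfl | rfl
  · exact (unit_mem_pat 0 j).1
  · exact (unit_mem_pat 1 j).1

/-- **A forward rung is a bond**: `(g, j) ∼ (g · R^j e₀, j′)` whenever `j′ = j + 1`. [folklore] -/
theorem reach_rung (g : Multiplicative (Site 2)) {j j' : Fin 4} (hj : j' = j + 1) :
    (PatternGraph.graph pat).Reachable (g, j) (g * Multiplicative.ofAdd (rot0 j), j') := by
  subst hj
  refine (PatternGraph.adj_of_mem pat (g, j) (rung_mem_pat j) fun e => ?_).reachable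
  have e2 := congrArg Prod.snd e
  dsimp only at e2
  revert e2
  fin_cases j <;> decide

/-- Every sheet reaches sheet `0` from its identity vertex (forward rungs `j → j+1 → ⋯ → 0`). [folklore] -/
theorem hlink : ∀ j : Fin 4, ∃ g : Multiplicative (Site 2), (PatternGraph.graph pat).Reachable ((1 : Multiplicative (Site 2)), j) (g, 0) := by
  intro j
  fin_cases j
  · exact ⟨1, Reachable.refl _⟩
  · exact ⟨_, ((reach_rung 1 (j := 1) (j' := 2) (by decide)).trans (reach_rung _ (j := 2) (j' := 3) (by decide))).trans
      (reach_rung _ (j := 3) (j' := 0) (by decide))⟩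
  · exact ⟨_, (reach_rung 1 (j := 2) (j' := 3) (by decide)).trans (reach_rung _ (j := 3) (j' := 0) (by decide))⟩
  · exact ⟨_, reach_rung 1 (j := 3) (j' := 0) (by decide)⟩

/-- **The four-sheet rotor graph with two rungs is connected.** [folklore] -/
theorem pat_connected : (PatternGraph.graph pat).Connected :=
  PatternGraph.connected_of_reach pat 0 (hsheet 0) hlink

/-! ## §3 The theorems (one application each of the front-end) -/

/-- **THEOREM (unconditional).  `θ_v(p_c) = 0` at every vertex of the four-sheet rotor graph with two rungs** (the coset picture of
`Cay(ℤ² ⋊ C₄; τ, ρτρ⁻¹, (e₀,ρ), (e₁,ρ))`) — by `PatternGraph.criticalContinuity` on the left `ℤ²`-translations (four orbits, chart = position, `N = 1`).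
builds on p205010 (kernel theorem, internal audit signed; external expert review pending). [cite: BenjaminiSchramm1996, Conj. 4; §2] -/
theorem criticalContinuity (v : Multiplicative (Site 2) × Fin 4) :
    theta (PatternGraph.graph pat) v (criticalProbIOf (PatternGraph.graph pat) v) = 0 :=
  PatternGraph.criticalContinuity pat (MonoidHom.id _) pat_connected hrange hstep v

/-- **Conj. 4 in its own shape** for the four-sheet rotor graph with two rungs: `p_c < 1 ∧ θ_v(p_c) = 0`.
builds on p205010 (kernel theorem, internal audit signed; external expert review pending). [cite: BenjaminiSchramm1996, Conj. 4; §2 Conj. 1] -/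
theorem conj4 (v : Multiplicative (Site 2) × Fin 4) :
    criticalProb (PatternGraph.graph pat) v < 1 ∧ theta (PatternGraph.graph pat) v (criticalProbIOf (PatternGraph.graph pat) v) = 0 :=
  PatternGraph.conj4 pat (MonoidHom.id _) pat_connected hrange hstep v

/-- **… and the same-`p` drop at every vertex.** builds on p205010 (kernel theorem, internal audit signed; external expert review pending).
[cite: BenjaminiSchramm1996, Conj. 4] -/
theorem drop (v : Multiplicative (Site 2) × Fin 4) (p : unitInterval) (hθ : 0 < theta (PatternGraph.graph pat) v p) :
    ∃ q : unitInterval, (q : ℝ) < p ∧ 0 < theta (PatternGraph.graph pat) v q :=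
  PatternGraph.drop pat (MonoidHom.id _) pat_connected hrange hstep v p hθ

end Z2RotC4TwoRungs

end Summit.CriticalPhenomena.PercolationContinuityZ3.Theorems.Transplant

end
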